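import Summits.QuantumFields.BalabanUV.T4Continuum.Spine.NE9.DirectPairingCauchy

/-!
# T⁴ programme, spine estimate NE9 — KING'S SOCKET IS STRICTLY WEAKER THAN THE CELL'S CONSECUTIVE NODE-U6 SOCKET: an explicit sequence of
# partition functions with King's matching (remainders → 0, hence Cauchy generating functions) that admits NO consecutive matching modulo
# constants with SUMMABLE remainders — census item C38e of cell `pub-balaban-gaps`, seat ne9 (gen 10)

Cell `pub-balaban-gaps` (YM blitz G2, seat ne9, unit `pub-balaban-gaps-ne9-g10`; record `run/shared/lean/pub/pub-balaban-gaps/ne/NE9.md` §5 row C38e).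
Summits-side bookkeeping; elementary real analysis over `T4CauchySum.MatchingModConstants` ∕ `genFun` and this seat's King socket
(`DirectPairingCauchy.cauchySeq_genFun_of_unif`).  NO definition (the witness is written inline); nothing of Bałaban's asserted.

WHY (two-sidedness of census C38∕C38b).  `DirectPairingCauchy.kingShape_of_matchingModConstants` (gen 6): the cell's consecutive socket — `MatchingModConstants vol l₀ δ Z`
with `Summable δ` (node U4′) — IMPLIES King's socket; `DirectPairingApexConverse` (gen 10): King's socket ⟺ the existence target.  Is the cell's socket
perhaps EQUIVALENT too?  NO: the witness `Z K t = exp(t·x_K)`, `x_K = (−1)^K∕(K + 1)` (positive numbers, so honest «partition functions» at the level of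
the abstract socket) has
* §1 `alt_kingShape`: King's matching with `c = 0`, `vol = l₀ = 1` and remainders `Δ_K = 2∕(K + 1) → 0` (`|x_{K+n} − x_K| ≤ 2∕(K + 1)`), hence
  (`alt_cauchySeq_genFun`) Cauchy generating functions by `cauchySeq_genFun_of_unif` — King's socket HOLDS;
* §2 `alt_not_matchingModConstants_summable`: for every `vol` and `l₀ > 0` there is NO `δ` with `Summable δ` and `MatchingModConstants vol l₀ δ Z` —
  matching at `t = 0` forces `|c_K| ≤ vol·δ_K`, at `t = l₀` then `l₀·|x_{K+1} − x_K| ≤ 2vol·δ_K`, and `|x_{K+1} − x_K| = 1∕(K+2) + 1∕(K+1) ≥ 1∕(K+1)` is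
  the harmonic series (`Real.not_summable_one_div_natCast`) — the cell's consecutive socket FAILS.
So, at the level of the sockets: consecutive-with-summable-remainders ⊊ King = existence target (`alt_strict`).  For the row this is the U5∕U6-level
counterpart of C26 (`MemoryFromRateSharp`: at node U3 the consecutive currency needs a quantitative E-side modulus that King's does not).

HONEST FRAMING: a statement about hypothesis SHAPES (abstract sequences `Z : ℕ → ℝ → ℝ`), NOT about Bałaban's dressed partition functions — whether a
lattice-gauge scheme can realise such a `Z` is neither claimed nor needed; NE9 ∕ NE7 NOT PRINTED ∕ NOT PROVED; spine PROVED 0∕9 unchanged; NOT UV stability,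
NOT the continuum limit, NOT infinite volume, NOT a mass gap, NOT Clay.  CLASSIFICATION OF NE9 UNCHANGED: WORK-bound (W1).

References (TYPES only): [King1986] = C. King, Commun. Math. Phys. **102** (1986) 649–677, Thm 3.4 (3.9) p. 656, p. 657.
-/

namespace Summit.QuantumFields.BalabanUV.T4Continuum.NE9.DirectPairingApexSharp

open Filter Topology
open Literature.MathematicalPhysics.QuantumFieldTheory.Balaban1983to89
open T4CauchySum (genFun MatchingModConstants)
open Summit.QuantumFields.BalabanUV.T4Continuum.NE9.DirectPairingCauchy (cauchySeq_genFun_of_unif)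

/-! ## §1 The witness satisfies King's socket -/

/-- `|(−1)^m ∕ (m + 1)| = 1 ∕ (m + 1)`. [folklore] -/
theorem abs_alt (m : ℕ) : |(-1 : ℝ) ^ m / ((m : ℝ) + 1)| = 1 / ((m : ℝ) + 1) := by
  have hm : (0 : ℝ) < (m : ℝ) + 1 := by positivity
  rw [abs_div, abs_pow, abs_neg, abs_one, one_pow, abs_of_pos hm]

/-- **KING'S MATCHING FOR THE WITNESS** `Z K t = exp(t·(−1)^K∕(K+1))`: with `c = 0`, `vol = l₀ = 1`, for all `K`, `n` and `|t| ≤ 1`,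
`|log Z_{K+n}(t) − log Z_K(t) − 0| ≤ 1·(2∕(K+1))` — the remainders `2∕(K+1)` tend to zero (and are NOT summable). [folklore] -/
theorem alt_kingShape :
    ∀ K n : ℕ, ∃ c : ℝ, ∀ t : ℝ, |t| ≤ 1 →
      |Real.log (Real.exp (t * ((-1 : ℝ) ^ (K + n) / (((K + n : ℕ) : ℝ) + 1)))) -
          Real.log (Real.exp (t * ((-1 : ℝ) ^ K / ((K : ℝ) + 1)))) - c| ≤ 1 * (2 / ((K : ℝ) + 1)) := by
  intro K n
  refine ⟨0, fun t ht => ?_⟩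
  rw [Real.log_exp, Real.log_exp, sub_zero, ← mul_sub, abs_mul, one_mul]
  have hK : (0 : ℝ) < (K : ℝ) + 1 := by positivity
  have hKn : (K : ℝ) + 1 ≤ ((K + n : ℕ) : ℝ) + 1 := by push_cast; linarith [(Nat.cast_nonneg n : (0 : ℝ) ≤ n)]
  have h1 : |(-1 : ℝ) ^ (K + n) / (((K + n : ℕ) : ℝ) + 1)| ≤ 1 / ((K : ℝ) + 1) := by
    rw [abs_alt]
    exact one_div_le_one_div_of_le hK hKn
  have h2 : |(-1 : ℝ) ^ K / ((K : ℝ) + 1)| ≤ 1 / ((K : ℝ) + 1) := (abs_alt K).le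
  have hdiff : |(-1 : ℝ) ^ (K + n) / (((K + n : ℕ) : ℝ) + 1) - (-1 : ℝ) ^ K / ((K : ℝ) + 1)| ≤ 2 / ((K : ℝ) + 1) := by
    calc |(-1 : ℝ) ^ (K + n) / (((K + n : ℕ) : ℝ) + 1) - (-1 : ℝ) ^ K / ((K : ℝ) + 1)|
        ≤ |(-1 : ℝ) ^ (K + n) / (((K + n : ℕ) : ℝ) + 1)| + |(-1 : ℝ) ^ K / ((K : ℝ) + 1)| := abs_sub _ _
      _ ≤ 1 / ((K : ℝ) + 1) + 1 / ((K : ℝ) + 1) := add_le_add h1 h2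
      _ = 2 / ((K : ℝ) + 1) := by ring
  calc |t| * |(-1 : ℝ) ^ (K + n) / (((K + n : ℕ) : ℝ) + 1) - (-1 : ℝ) ^ K / ((K : ℝ) + 1)|
      ≤ 1 * (2 / ((K : ℝ) + 1)) := mul_le_mul ht hdiff (abs_nonneg _) zero_le_one
    _ = 2 / ((K : ℝ) + 1) := one_mul _

/-- The remainders `2∕(K+1)` tend to zero. [folklore] -/
theorem tendsto_two_div_succ : Tendsto (fun K : ℕ => 2 / ((K : ℝ) + 1)) atTop (𝓝 0) := by
  have h := (tendsto_one_div_add_atTop_nhds_zero_nat).const_mul (2 : ℝ)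
  rw [mul_zero] at h
  refine h.congr fun K => ?_
  ring

/-- **… HENCE KING'S SOCKET HOLDS FOR THE WITNESS**: every generating function `K ↦ genFun Z K t`, `|t| ≤ 1`, is Cauchy
(`DirectPairingCauchy.cauchySeq_genFun_of_unif`). [folklore] -/
theorem alt_cauchySeq_genFun {t : ℝ} (ht : |t| ≤ 1) :
    CauchySeq fun K => genFun (fun K t => Real.exp (t * ((-1 : ℝ) ^ K / ((K : ℝ) + 1)))) K t :=
  cauchySeq_genFun_of_unif (Z := fun K t => Real.exp (t * ((-1 : ℝ) ^ K / ((K : ℝ) + 1)))) (vol := 1) (l₀ := 1)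
    (δ := fun K => 2 / ((K : ℝ) + 1)) alt_kingShape zero_le_one tendsto_two_div_succ ht

/-! ## §2 … but the cell's consecutive socket with SUMMABLE remainders fails for it -/

/-- Consecutive differences of the witness exponents are at least harmonic: `1∕(K+1) ≤ |x_{K+1} − x_K|`. [folklore] -/
theorem harmonic_le_abs_alt_sub (K : ℕ) :
    1 / ((K : ℝ) + 1) ≤ |(-1 : ℝ) ^ (K + 1) / (((K + 1 : ℕ) : ℝ) + 1) - (-1 : ℝ) ^ K / ((K : ℝ) + 1)| := by
  have hK : (0 : ℝ) < (K : ℝ) + 1 := by positivity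
  have hK2 : (0 : ℝ) < (K : ℝ) + 1 + 1 := by positivity
  have e : (-1 : ℝ) ^ (K + 1) / (((K + 1 : ℕ) : ℝ) + 1) - (-1 : ℝ) ^ K / ((K : ℝ) + 1) =
      -((-1 : ℝ) ^ K) * (1 / ((K : ℝ) + 1 + 1) + 1 / ((K : ℝ) + 1)) := by
    push_cast
    rw [pow_succ]
    ring
  rw [e, abs_mul, abs_neg, abs_pow, abs_neg, abs_one, one_pow, one_mul,
    abs_of_pos (add_pos (one_div_pos.2 hK2) (one_div_pos.2 hK))]
  linarith [(one_div_pos.2 hK2).le]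

/-- **NO CONSECUTIVE MATCHING WITH SUMMABLE REMAINDERS**: for every `vol` and every `l₀ > 0`, the witness admits no `δ` with `Summable δ` and
`MatchingModConstants vol l₀ δ Z`.  Matching at `t = 0` gives `|c_K| ≤ vol·δ_K`, at `t = l₀` then `l₀·|x_{K+1} − x_K| ≤ 2vol·δ_K`, and `|x_{K+1} − x_K|` is
at least harmonic — not summable (`Real.not_summable_one_div_natCast`). [folklore] -/
theorem alt_not_matchingModConstants_summable {vol l₀ : ℝ} (hl₀ : 0 < l₀) :
    ¬ ∃ δ : ℕ → ℝ, Summable δ ∧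
      MatchingModConstants vol l₀ δ (fun K t => Real.exp (t * ((-1 : ℝ) ^ K / ((K : ℝ) + 1)))) := by
  rintro ⟨δ, hδs, hM⟩
  -- from the matching: the harmonic terms are dominated by `(2·vol∕l₀)·δ_K`
  have hdom : ∀ K : ℕ, 1 / ((K : ℝ) + 1) ≤ (2 * vol / l₀) * δ K := by
    intro K
    obtain ⟨c, hc⟩ := hM K
    have h0 := hc 0 (by rw [abs_zero]; exact hl₀.le)
    have h1 := hc l₀ (by rw [abs_of_pos hl₀])
    simp only [Real.log_exp, zero_mul, sub_zero] at h0
    rw [Real.log_exp, Real.log_exp, ← mul_sub] at h1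
    rw [zero_sub, abs_neg] at h0
    -- |l₀·d − c| ≤ vol δ_K and |c| ≤ vol δ_K ⇒ l₀|d| ≤ 2 vol δ_K
    have hd : l₀ * |(-1 : ℝ) ^ (K + 1) / (((K + 1 : ℕ) : ℝ) + 1) - (-1 : ℝ) ^ K / ((K : ℝ) + 1)| ≤ 2 * vol * δ K := by
      have htri := abs_add_le (l₀ * ((-1 : ℝ) ^ (K + 1) / (((K + 1 : ℕ) : ℝ) + 1) - (-1 : ℝ) ^ K / ((K : ℝ) + 1)) - c) c
      rw [sub_add_cancel, abs_mul, abs_of_pos hl₀] at htri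
      linarith
    have hh := harmonic_le_abs_alt_sub K
    rw [div_mul_eq_mul_div, le_div_iff₀ hl₀]
    calc 1 / ((K : ℝ) + 1) * l₀ = l₀ * (1 / ((K : ℝ) + 1)) := by ring
      _ ≤ l₀ * |(-1 : ℝ) ^ (K + 1) / (((K + 1 : ℕ) : ℝ) + 1) - (-1 : ℝ) ^ K / ((K : ℝ) + 1)| :=
          mul_le_mul_of_nonneg_left hh hl₀.le
      _ ≤ 2 * vol * δ K := hd
  have hsum : Summable fun K : ℕ => 1 / ((K : ℝ) + 1) :=
    Summable.of_nonneg_of_le (fun K => by positivity) hdom (hδs.mul_left _)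
  -- the harmonic series (shifted by one) is not summable
  have hh : Summable fun n : ℕ => 1 / ((n : ℕ) : ℝ) := by
    rw [← summable_nat_add_iff 1]
    refine hsum.congr fun K => ?_
    push_cast
    rfl
  exact Real.not_summable_one_div_natCast hh

/-- **KING'S SOCKET IS STRICTLY WEAKER THAN THE CELL'S CONSECUTIVE SOCKET** (at the level of the abstract sockets): there is a sequence of positive
«partition functions» with King's matching (remainders → 0, uniformly in `n`; hence Cauchy generating functions) and NO consecutive matching modulo
constants with summable remainders, whatever `vol` and `l₀ > 0`.  With `kingShape_of_matchingModConstants` (consecutive ⇒ King) and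
`DirectPairingApexConverse.king_iff_hasContinuumLimit` (King ⟺ existence): consecutive-with-summable-remainders ⊊ King = the existence target. [folklore] -/
theorem alt_strict :
    ∃ Z : ℕ → ℝ → ℝ, (∀ K t, 0 < Z K t) ∧
      (∃ Δ : ℕ → ℝ, Tendsto Δ atTop (𝓝 0) ∧
        ∀ K n : ℕ, ∃ c : ℝ, ∀ t : ℝ, |t| ≤ 1 → |Real.log (Z (K + n) t) - Real.log (Z K t) - c| ≤ 1 * Δ K) ∧
      ∀ vol l₀ : ℝ, 0 < l₀ → ¬ ∃ δ : ℕ → ℝ, Summable δ ∧ MatchingModConstants vol l₀ δ Z := by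
  refine ⟨fun K t => Real.exp (t * ((-1 : ℝ) ^ K / ((K : ℝ) + 1))), fun K t => Real.exp_pos _,
    ⟨fun K => 2 / ((K : ℝ) + 1), tendsto_two_div_succ, fun K n => ?_⟩,
    fun vol l₀ hl₀ => alt_not_matchingModConstants_summable hl₀⟩
  obtain ⟨c, hc⟩ := alt_kingShape K n
  refine ⟨c, fun t ht => ?_⟩
  have h := hc t ht
  push_cast at h ⊢
  exact h

end Summit.QuantumFields.BalabanUV.T4Continuum.NE9.DirectPairingApexSharp
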